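import Literature.Computability.Complexity.LadnerCookSim
import HarnessLib

/-!
# Ladner's theorem: one budgeted look back (the resolve brick of the diagonalizer)

Sixth layer of the discharge of `Literature.Computability.Complexity.ladner` (`StructuralPH.lean`).
At stage `n` the diagonalizer (Ladner 1975, §3; Homer–Selman 2011, Thm. 7.6 with Lemma 7.1;
Chew–Machtey 1981, §2: "spend up to small(x) cost finding …") examines ONE candidate witness `z`
against the current requirement, coded `c = ⟨e, u⟩` (machine/procedure code `e`, clock exponent
`|u|`) of type `typ` (`1`: the presented `P` language `stdLp c`; `0`: the presented oracle
procedure `c` with oracle `B`), within its budget: every quantity it would have to compute — the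
clocks `K₁ = (|z|+2)^{|u|+1}`, `K₂` of the procedure and the `2^{p(K₁)+1}` certificates of the
exhaustive searches — is first compared with the budget `n = |tbl| - 1` (`tbl` its table of
parities of `g 0, …, g n`), and the look back is abandoned (`none`) if the budget does not afford
it. This file builds the brick and its table-relative semantics:

* `Ladner.resolveSem χ p U tbl c typ z : Option Bool` — the semantics: `none` if over budget,
  otherwise whether `z` witnesses the requirement, membership in `B` being read through the table
  (`Ladner.Osem`: certificate search for `A` and the complemented parity `tbl[|·|]`);
* `Ladner.resolveFn χ p χU ∈ FP` and **`Ladner.resolveFn_apply`**: on the record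
  `⟨x, ⟨tbl, ⟨c, ⟨typ, z⟩⟩⟩⟩` with `|tbl|, |c| ≤ |x|` the brick returns the code of `resolveSem`
  (`0` / `1 b`).

## References

* R. E. Ladner, *On the structure of polynomial time reducibility*, J. ACM 22 (1975) 155–171, §3.
* S. Homer, A. L. Selman, *Computability and Complexity Theory*, 2nd ed., Springer 2011, Lemma 7.1,
  Thm. 7.6 (proof). doi:10.1007/978-1-4614-0682-2
* P. Chew, M. Machtey, *A note on structure and looking back …*, JCSS 22 (1981) 53–59, §2.
-/

noncomputable section

namespace Literature.Computability.Complexity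

open _root_.Computability Polynomial Brick
open HashBricks (headBitFn headBitFn_apply headBitFn_mem_FP oneBit_headBitFn xorFn xorFn_apply)

namespace Ladner

/-! ### Table-relative semantics -/

section Sem

variable (χ : List Bool → List Bool) (p : Polynomial ℕ)

open Classical in
/-- Certificate search: `[∃ y, |y| ≤ p|w| ∧ χ ⟨w, y⟩ = 1 …]`. [cite: AroraBarakCC2009, Claim 2.4] -/
def Asem (w : List Bool) : Bool :=
  decide (∃ y : List Bool, y.length ≤ p.eval w.length ∧ (χ (boolPair w y)).headD false = true)

/-- The looked-back oracle bit read through the table: `Asem w ∧ ¬ tbl[|w|]`. [cite: HomerSelman2011, Thm. 7.6 (proof)] -/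
def Osem (tbl w : List Bool) : Bool :=
  Asem χ p w && !(tbl.getD w.length false)

/-- The output of the clocked procedure `⟨e; K₁, K₂⟩` on `z` against the looked-back oracle.
[cite: HomerSelman2011, Lemma 7.2 (proof)] -/
def cookSem (tbl e : List Bool) (K₁ K₂ : ℕ) (z : List Bool) : Bool :=
  ((procCore e K₁ K₂).runAux (fun y => [Osem χ p tbl y]) z (K₁ + 1) []).getD false

/-- The budget test of a look back at `z` against the requirement of clock exponent `kk`, with
budget `n`: the clocks and the number of certificates must not exceed `n`. [cite: ChewMachtey1981, §2] -/
def Afford (n kk : ℕ) (z : List Bool) : Prop :=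
  clock₁ kk z ≤ n ∧ clock₂ kk z ≤ n ∧ 2 ^ (p.eval (clock₁ kk z) + 1) ≤ n

/-- The budget test is decidable. [folklore] -/
instance (n kk : ℕ) (z : List Bool) : Decidable (Afford p n kk z) := by
  unfold Afford; infer_instance

/-- **Semantics of one look back** at candidate `z` against requirement `(c, typ)` with table `tbl`
(budget `|tbl| - 1`): over budget `none`; otherwise, for `typ = 1`, whether `B` and the presented
`P` language of `c` differ at `z`, and for `typ = 0`, whether `A` and the presented procedure `c`
with oracle `B` differ at `z` — memberships in `B` read through the table.
[cite: HomerSelman2011, Thm. 7.6 (proof)] -/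
def resolveSem (U : Language Bool) (tbl c : List Bool) (typ : Bool) (z : List Bool) : Option Bool :=
  let e := (boolUnpair c).1
  let kk := (boolUnpair c).2.length
  if Afford p (tbl.length - 1) kk z then
    some (if typ then (Osem χ p tbl z != U.boolIndicator (accInst c z))
      else (Asem χ p z != cookSem χ p tbl e (clock₁ kk z) (clock₂ kk z) z))
  else none

/-- The code of an optional bit with a tag: `none ↦ 0`, `some b ↦ 1 b`. [folklore] -/
def encOpt : Option Bool → List Bool
  | none => [false]
  | some b => [true, b]

end Sem

/-! ### The brick -/

section BrickDef

variable (χ : List Bool → List Bool) (p : Polynomial ℕ) (χU : List Bool → List Bool)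

/-! Fields of the record `ρ = ⟨x, ⟨tbl, ⟨c, ⟨typ, z⟩⟩⟩⟩`: `nthF 0 … nthF 3`, `sndPow 3`. -/

/-- The numeral of the budget `n = |tbl| - 1`. [folklore] -/
def budF : List Bool → List Bool := lenBinF ∘ List.tail ∘ nthF 1

/-- The numeral of the clock exponent `|u| + 1`, `c = ⟨e, u⟩`. [folklore] -/
def expF : List Bool → List Bool := lenBinF ∘ List.cons true ∘ sndF ∘ nthF 2

/-- The numeral of `K₁ = (|z|+2)^{|u|+1}`. [folklore] -/
def k1F : List Bool → List Bool :=
  powFn ∘ fanoutFn (fanoutFn (nthF 0) (lenBinF ∘ List.cons false ∘ List.cons false ∘ sndPow 3)) expF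

/-- The numeral of `K₂ = (2|z| + 6K₁ + 6)^{|u|+1}`. [folklore] -/
def k2F : List Bool → List Bool :=
  powFn ∘ fanoutFn (fanoutFn (nthF 0) (addFn ∘ fanoutFn
    (prodFn ∘ fanoutFn (fun _ => encodeNat 6) k1F)
    (addFn ∘ fanoutFn (prodFn ∘ fanoutFn (fun _ => encodeNat 2) (lenBinF ∘ sndPow 3)) (fun _ => encodeNat 6))))
    expF

/-- The clock `1^{K₁}` (materialized with the table as ruler: exact once `K₁ ≤ n`). [folklore] -/
def ones1F : List Bool → List Bool := binToUnaryFn ∘ fanoutFn (nthF 1) k1F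

/-- The budget `1^{K₂}` (materialized with the table as ruler). [folklore] -/
def ones2F : List Bool → List Bool := binToUnaryFn ∘ fanoutFn (nthF 1) k2F

/-- The numeral of the clock `(|z|+2)^{|u|}` of the presented `P` language of `c` (`Ladner.accInst`).
[folklore] -/
def k0F : List Bool → List Bool :=
  powFn ∘ fanoutFn (fanoutFn (nthF 0) (lenBinF ∘ List.cons false ∘ List.cons false ∘ sndPow 3))
    (lenBinF ∘ sndF ∘ nthF 2)

/-- The clock `1^{(|z|+2)^{|u|}}` of the presented `P` language (materialized with the table as ruler).
[folklore] -/
def ones0F : List Bool → List Bool := binToUnaryFn ∘ fanoutFn (nthF 1) k0F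

/-- Appending the bit `1`. [folklore] -/
def snocTrueF : List Bool → List Bool := fun w => w ++ [true]

/-- `snocTrueF ∈ FP`. [folklore] -/
theorem snocTrueF_mem_FP : snocTrueF ∈ FP :=
  append_mem_FP (f := id) (g := fun _ => [true]) OracleCompose.id_mem_FP (const_mem_FP _)

/-- The numeral of the number of certificates `2^{p(K₁)+1}`: `0^{p(K₁)+1} 1`. [folklore] -/
def wF : List Bool → List Bool :=
  snocTrueF ∘ Kannan.zerosFn ∘ List.cons true ∘ Plumb.polyFn p ∘ ones1F

/-- **The budget test** `[K₁ ≤ n ∧ K₂ ≤ n ∧ 2^{p(K₁)+1} ≤ n]`. [cite: ChewMachtey1981, §2 ("spend up to small(x) cost")] -/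
def affordF : List Bool → List Bool :=
  andFn (leF ∘ fanoutFn k1F budF) (andFn (leF ∘ fanoutFn k2F budF) (leF ∘ fanoutFn (wF p) budF))

/-- The bit `[z ∈ B]` through the table. [folklore] -/
def bzF : List Bool → List Bool := oracleFn χ p ∘ fanoutFn (nthF 0) (fanoutFn (nthF 1) (sndPow 3))

/-- The bit `[z ∈ A]`. [folklore] -/
def azF : List Bool → List Bool := headBitFn ∘ searchFn χ p ∘ fanoutFn (nthF 0) (sndPow 3)

/-- The bit `[accInst c z ∈ U]` (the presented `P` language of `c` at `z`). [folklore] -/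
def accF : List Bool → List Bool :=
  headBitFn ∘ χU ∘ fanoutFn (fstF ∘ nthF 2) (fanoutFn (sndPow 3) ones0F)

/-- The output bit of the presented procedure `c` with the looked-back oracle at `z`. [folklore] -/
def ckF : List Bool → List Bool :=
  headBitFn ∘ cookFn χ p ∘ fanoutFn
    (fanoutFn (nthF 0) (fanoutFn (nthF 1) (fanoutFn (fstF ∘ nthF 2) (fanoutFn ones1F ones2F))))
    (sndPow 3)

/-- **The resolve brick**: `0` over budget, else `1 w` with the witness bit `w` of the requirement
type. [cite: HomerSelman2011, Thm. 7.6 (proof)] -/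
def resolveFn : List Bool → List Bool :=
  iteFn (affordF p)
    (List.cons true ∘ iteFn (headBitFn ∘ nthF 3) (xorFn (bzF χ p) (accF χU)) (xorFn (azF χ p) (ckF χ p)))
    (fun _ => [false])

/-! ### Membership in `FP` -/

/-- `budF ∈ FP`. [folklore] -/
theorem budF_mem_FP : budF ∈ FP :=
  comp_mem_FP lenBinF_mem_FP (comp_mem_FP PRelSigma.tail_mem_FP (nthF_mem_FP 1))

/-- `expF ∈ FP`. [folklore] -/
theorem expF_mem_FP : expF ∈ FP :=
  comp_mem_FP lenBinF_mem_FP (comp_mem_FP (cons_mem_FP true) (comp_mem_FP sndF_mem_FP (nthF_mem_FP 2)))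

/-- `k1F ∈ FP`. [folklore] -/
theorem k1F_mem_FP : k1F ∈ FP :=
  comp_mem_FP powFn_mem_FP (fanoutFn_mem_FP (fanoutFn_mem_FP (nthF_mem_FP 0)
    (comp_mem_FP lenBinF_mem_FP (comp_mem_FP (cons_mem_FP false) (comp_mem_FP (cons_mem_FP false) (sndPow_mem_FP 3)))))
    expF_mem_FP)

/-- `k2F ∈ FP`. [folklore] -/
theorem k2F_mem_FP : k2F ∈ FP :=
  comp_mem_FP powFn_mem_FP (fanoutFn_mem_FP (fanoutFn_mem_FP (nthF_mem_FP 0)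
    (comp_mem_FP addFn_mem_FP (fanoutFn_mem_FP
      (comp_mem_FP prodFn_mem_FP (fanoutFn_mem_FP (const_mem_FP _) k1F_mem_FP))
      (comp_mem_FP addFn_mem_FP (fanoutFn_mem_FP
        (comp_mem_FP prodFn_mem_FP (fanoutFn_mem_FP (const_mem_FP _) (comp_mem_FP lenBinF_mem_FP (sndPow_mem_FP 3))))
        (const_mem_FP _))))))
    expF_mem_FP)

/-- `ones1F ∈ FP`. [folklore] -/
theorem ones1F_mem_FP : ones1F ∈ FP :=
  comp_mem_FP binToUnaryFn_mem_FP (fanoutFn_mem_FP (nthF_mem_FP 1) k1F_mem_FP)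

/-- `ones2F ∈ FP`. [folklore] -/
theorem ones2F_mem_FP : ones2F ∈ FP :=
  comp_mem_FP binToUnaryFn_mem_FP (fanoutFn_mem_FP (nthF_mem_FP 1) k2F_mem_FP)

/-- `k0F ∈ FP`. [folklore] -/
theorem k0F_mem_FP : k0F ∈ FP :=
  comp_mem_FP powFn_mem_FP (fanoutFn_mem_FP (fanoutFn_mem_FP (nthF_mem_FP 0)
    (comp_mem_FP lenBinF_mem_FP (comp_mem_FP (cons_mem_FP false) (comp_mem_FP (cons_mem_FP false) (sndPow_mem_FP 3)))))
    (comp_mem_FP lenBinF_mem_FP (comp_mem_FP sndF_mem_FP (nthF_mem_FP 2))))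

/-- `ones0F ∈ FP`. [folklore] -/
theorem ones0F_mem_FP : ones0F ∈ FP :=
  comp_mem_FP binToUnaryFn_mem_FP (fanoutFn_mem_FP (nthF_mem_FP 1) k0F_mem_FP)

/-- `wF ∈ FP`. [folklore] -/
theorem wF_mem_FP : wF p ∈ FP :=
  comp_mem_FP snocTrueF_mem_FP (comp_mem_FP Kannan.zerosFn_mem_FP (comp_mem_FP (cons_mem_FP true)
    (comp_mem_FP (Plumb.polyFn_mem_FP p) ones1F_mem_FP)))

/-- `affordF ∈ FP`. [folklore] -/
theorem affordF_mem_FP : affordF p ∈ FP :=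
  andFn_mem_FP (comp_mem_FP leF_mem_FP (fanoutFn_mem_FP k1F_mem_FP budF_mem_FP))
    (andFn_mem_FP (comp_mem_FP leF_mem_FP (fanoutFn_mem_FP k2F_mem_FP budF_mem_FP))
      (comp_mem_FP leF_mem_FP (fanoutFn_mem_FP (wF_mem_FP p) budF_mem_FP)))

variable {χ χU}

/-- `bzF ∈ FP`. [folklore] -/
theorem bzF_mem_FP (hχ : χ ∈ FP) : bzF χ p ∈ FP :=
  comp_mem_FP (oracleFn_mem_FP χ p hχ) (fanoutFn_mem_FP (nthF_mem_FP 0) (fanoutFn_mem_FP (nthF_mem_FP 1) (sndPow_mem_FP 3)))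

/-- `azF ∈ FP`. [folklore] -/
theorem azF_mem_FP (hχ : χ ∈ FP) : azF χ p ∈ FP :=
  comp_mem_FP headBitFn_mem_FP (comp_mem_FP (searchFn_mem_FP χ p hχ) (fanoutFn_mem_FP (nthF_mem_FP 0) (sndPow_mem_FP 3)))

/-- `accF ∈ FP`. [folklore] -/
theorem accF_mem_FP (hU : χU ∈ FP) : accF χU ∈ FP :=
  comp_mem_FP headBitFn_mem_FP (comp_mem_FP hU (fanoutFn_mem_FP (comp_mem_FP fstF_mem_FP (nthF_mem_FP 2))
    (fanoutFn_mem_FP (sndPow_mem_FP 3) ones0F_mem_FP)))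

/-- `ckF ∈ FP`. [folklore] -/
theorem ckF_mem_FP (hχ : χ ∈ FP) : ckF χ p ∈ FP :=
  comp_mem_FP headBitFn_mem_FP (comp_mem_FP (cookFn_mem_FP χ p hχ) (fanoutFn_mem_FP
    (fanoutFn_mem_FP (nthF_mem_FP 0) (fanoutFn_mem_FP (nthF_mem_FP 1) (fanoutFn_mem_FP (comp_mem_FP fstF_mem_FP (nthF_mem_FP 2))
      (fanoutFn_mem_FP ones1F_mem_FP ones2F_mem_FP))))
    (sndPow_mem_FP 3)))

/-- **`resolveFn ∈ FP`** for `χ, χU ∈ FP`. [cite: AroraBarakCC2009, §1.3] -/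
theorem resolveFn_mem_FP (hχ : χ ∈ FP) (hU : χU ∈ FP) : resolveFn χ p χU ∈ FP :=
  iteFn_mem_FP (affordF_mem_FP p)
    (comp_mem_FP (cons_mem_FP true) (iteFn_mem_FP (comp_mem_FP headBitFn_mem_FP (nthF_mem_FP 3))
      (HashBricks.xorFn_mem_FP (bzF_mem_FP p hχ) (accF_mem_FP hU))
      (HashBricks.xorFn_mem_FP (azF_mem_FP p hχ) (ckF_mem_FP p hχ))))
    (const_mem_FP _)

/-- The output of `resolveFn` has length at most `2`. [folklore] -/
theorem length_resolveFn_le (ρ : List Bool) : (resolveFn χ p χU ρ).length ≤ 2 := by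
  have hone : OneBit (affordF p) := oneBit_andFn (oneBit_leF.comp _) (oneBit_andFn (oneBit_leF.comp _) (oneBit_leF.comp _))
  have hw : OneBit (iteFn (headBitFn ∘ nthF 3) (xorFn (bzF χ p) (accF χU)) (xorFn (azF χ p) (ckF χ p))) :=
    (oneBit_headBitFn.comp _).ite
      (HashBricks.oneBit_xorFn ((oneBit_oracleFn χ p).comp _) (oneBit_headBitFn.comp _))
      (HashBricks.oneBit_xorFn (oneBit_headBitFn.comp _) (oneBit_headBitFn.comp _))
  unfold resolveFn
  rw [iteFn_of_oneBit hone]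
  split_ifs
  · show (true :: _).length ≤ 2
    rw [List.length_cons, hw.length_eq]
  · simp

end BrickDef

/-! ### Semantics of the brick -/

section Semantics

/-- The numeral of a power of two: `0ʲ 1` (as `TodaPartTwo.bitsToNat_zeros_one`, kept private here).
[folklore] -/
private theorem bitsToNat_replicate_false_append_true (j : ℕ) :
    bitsToNat (List.replicate j false ++ [true]) = 2 ^ j := by
  rw [bitsToNat_append]; simp

variable {χ : List Bool → List Bool} {p : Polynomial ℕ} {U : Language Bool}

/-- **Value of the resolve brick** on an honest record `⟨x, ⟨tbl, ⟨c, ⟨typ, z⟩⟩⟩⟩` (table and code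
no longer than the yardstick `x`): the code of `resolveSem`.
[cite: HomerSelman2011, Thm. 7.6 (proof)] -/
theorem resolveFn_apply (x tbl c z : List Bool) (typ : Bool) (htbl : tbl.length ≤ x.length)
    (hc : c.length ≤ x.length) :
    resolveFn χ p (fun w => [U.boolIndicator w]) (boolPair x (boolPair tbl (boolPair c (boolPair [typ] z)))) =
      encOpt (resolveSem χ p U tbl c typ z) := by
  -- names
  set ρ := boolPair x (boolPair tbl (boolPair c (boolPair [typ] z))) with hρ
  set e := (boolUnpair c).1 with he
  set u := (boolUnpair c).2 with hu
  set kk := u.length with hkk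
  set n := tbl.length - 1 with hn
  set K₁ := clock₁ kk z with hK₁
  set K₂ := clock₂ kk z with hK₂
  have hukk : kk ≤ x.length := (OracleCompose.length_boolUnpair_snd_le_length c).trans hc
  -- fields
  have f0 : nthF 0 ρ = x := by simp [hρ, nthF]
  have f1 : nthF 1 ρ = tbl := by simp [hρ, nthF]
  have f2 : nthF 2 ρ = c := by simp [hρ, nthF]
  have f3 : nthF 3 ρ = [typ] := by simp [hρ, nthF]
  have f4 : sndPow 3 ρ = z := by simp [hρ, sndPow]
  have hfe : fstF c = e := rfl
  have hsu : sndF c = u := rfl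
  -- numerals
  have hbud : budF ρ = encodeNat n := by
    simp only [budF, Function.comp_apply, f1, lenBinF_apply, List.length_tail, hn]
  have hexp : expF ρ = encodeNat (kk + 1) := by
    simp only [expF, Function.comp_apply, f2, hsu, lenBinF_apply, List.length_cons, hkk]
  have hk1 : k1F ρ = encodeNat K₁ := by
    simp only [k1F, Function.comp_apply, fanoutFn_apply, f0, f4, hexp, lenBinF_apply, List.length_cons]
    rw [powFn_apply _ _ (by rw [length_boolPair]; omega), bitsToNat_encodeNat, hK₁]
    simp [clock₁]
  have hk2 : k2F ρ = encodeNat K₂ := by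
    simp only [k2F, Function.comp_apply, fanoutFn_apply, f0, f4, hexp, hk1, lenBinF_apply,
      addFn_boolPair, prodFn_boolPair, bitsToNat_encodeNat]
    rw [powFn_apply _ _ (by rw [length_boolPair]; omega), bitsToNat_encodeNat, hK₂]
    unfold clock₂
    rw [← hK₁]
    congr 2
    ring
  -- the budget test
  have haff : affordF p ρ = [decide (Afford p n kk z)] := by
    have h1 : (leF ∘ fanoutFn k1F budF) ρ = [decide (K₁ ≤ n)] := by
      simp only [Function.comp_apply, fanoutFn_apply, hk1, hbud, leF_boolPair, bitsToNat_encodeNat]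
    have h2 : (leF ∘ fanoutFn k2F budF) ρ = [decide (K₂ ≤ n)] := by
      simp only [Function.comp_apply, fanoutFn_apply, hk2, hbud, leF_boolPair, bitsToNat_encodeNat]
    have h3 : (leF ∘ fanoutFn (wF p) budF) ρ =
        [decide (2 ^ (p.eval (ones1F ρ).length + 1) ≤ n)] := by
      simp only [Function.comp_apply, fanoutFn_apply, hbud, leF_boolPair, bitsToNat_encodeNat, wF,
        snocTrueF, Kannan.zerosFn_apply, List.length_cons, Plumb.polyFn_apply, List.length_replicate,
        bitsToNat_replicate_false_append_true]
    unfold affordF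
    rw [andFn_apply h1 (andFn_apply h2 h3)]
    by_cases hK : K₁ ≤ n
    · have hones : (ones1F ρ).length = K₁ := by
        simp only [ones1F, Function.comp_apply, fanoutFn_apply, f1, hk1, binToUnaryFn_boolPair,
          bitsToNat_encodeNat, List.length_replicate]
        omega
      rw [hones]
      simp only [Afford, ← hK₁, ← hK₂]
      by_cases h2' : K₂ ≤ n <;> by_cases h3' : 2 ^ (p.eval K₁ + 1) ≤ n <;> simp [hK, h2', h3']
    · have : ¬ Afford p n kk z := fun h => hK (hK₁ ▸ h.1)
      simp [hK, this]
  -- over budget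
  unfold resolveFn resolveSem
  simp only [← he, ← hu, ← hkk, ← hn, ← hK₁, ← hK₂]
  by_cases hA : Afford p n kk z
  swap
  · rw [iteFn_apply_false (by rw [haff]; simp [hA]), if_neg hA]
    rfl
  rw [iteFn_apply_true (by rw [haff]; simp [hA]), if_pos hA]
  obtain ⟨hA1, hA2, hA3⟩ := hA
  have hA1' : K₁ ≤ n := hA1
  have hA2' : K₂ ≤ n := hA2
  have hA3' : 2 ^ (p.eval K₁ + 1) ≤ n := hA3
  clear hA1 hA2 hA3
  -- consequences of the budget
  have htbl0 : n < tbl.length := by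
    have : 2 ≤ K₁ := by
      rw [hK₁]; unfold clock₁
      calc 2 ≤ (z.length + 2) ^ 1 := by simp
        _ ≤ (z.length + 2) ^ (kk + 1) := Nat.pow_le_pow_right (by omega) (by omega)
    omega
  have hzK : z.length < K₁ := hK₁ ▸ length_lt_clock₁ kk z
  have hones1 : ones1F ρ = ones K₁ := by
    simp only [ones1F, Function.comp_apply, fanoutFn_apply, f1, hk1, binToUnaryFn_boolPair,
      bitsToNat_encodeNat]
    congr 1; omega
  have hones2 : ones2F ρ = ones K₂ := by
    simp only [ones2F, Function.comp_apply, fanoutFn_apply, f1, hk2, binToUnaryFn_boolPair,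
      bitsToNat_encodeNat]
    congr 1; omega
  -- the looked-back oracle is right on short queries
  have hO : ∀ y : List Bool, y.length ≤ K₁ →
      oracleFn χ p (boolPair x (boolPair tbl y)) = [Osem χ p tbl y] := by
    intro y hy
    have hy' : y.length < tbl.length := by omega
    have hpow : 2 ^ (p.eval y.length + 1) - 1 ≤ (boolPair x y).length := by
      have hm : p.eval y.length ≤ p.eval K₁ := TM2Iter.eval_mono p hy
      have : 2 ^ (p.eval y.length + 1) ≤ 2 ^ (p.eval K₁ + 1) := Nat.pow_le_pow_right (by omega) (by omega)
      rw [length_boolPair]; omega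
    rw [oracleFn_apply χ p hy' hpow]
    simp only [Osem, Asem, List.getD_eq_getElem _ _ hy']
  -- the bits
  have hbz : bzF χ p ρ = [Osem χ p tbl z] := by
    simp only [bzF, Function.comp_apply, fanoutFn_apply, f0, f1, f4]
    exact hO z hzK.le
  have haz : azF χ p ρ = [Asem χ p z] := by
    have hpow : 2 ^ (p.eval z.length + 1) - 1 ≤ (boolPair x z).length := by
      have hm : p.eval z.length ≤ p.eval K₁ := TM2Iter.eval_mono p hzK.le
      have : 2 ^ (p.eval z.length + 1) ≤ 2 ^ (p.eval K₁ + 1) := Nat.pow_le_pow_right (by omega) (by omega)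
      rw [length_boolPair]; omega
    simp only [azF, Function.comp_apply, fanoutFn_apply, f0, f4, searchFn_apply χ p hpow, Asem,
      headBitFn_apply, List.headD_cons]
  have hacc : accF (fun w => [U.boolIndicator w]) ρ = [U.boolIndicator (accInst c z)] := by
    have hk0 : k0F ρ = encodeNat ((z.length + 2) ^ kk) := by
      simp only [k0F, Function.comp_apply, fanoutFn_apply, f0, f2, hsu, f4, lenBinF_apply, List.length_cons]
      rw [powFn_apply _ _ (by rw [length_boolPair]; omega), bitsToNat_encodeNat]
    have hK0 : (z.length + 2) ^ kk ≤ K₁ := by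
      rw [hK₁]; unfold clock₁
      exact Nat.pow_le_pow_right (by omega) (Nat.le_succ kk)
    have hones0 : ones0F ρ = ones ((z.length + 2) ^ kk) := by
      simp only [ones0F, Function.comp_apply, fanoutFn_apply, f1, hk0, binToUnaryFn_boolPair,
        bitsToNat_encodeNat]
      congr 1; omega
    simp only [accF, Function.comp_apply, fanoutFn_apply, f2, hfe, f4, hones0, headBitFn_apply,
      List.headD_cons, accInst_apply, he, hu, hkk]
  have hck : ckF χ p ρ = [cookSem χ p tbl e K₁ K₂ z] := by
    obtain ⟨b, hb⟩ := runAux_isSome_core e K₁ K₂ (fun y => [Osem χ p tbl y]) z (K₁ + 1) []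
      (by omega) (by simp)
    have hO' : ∀ y : List Bool, y.length ≤ (ones K₁).length →
        oracleFn χ p (boolPair x (boolPair tbl y)) = [Osem χ p tbl y] :=
      fun y hy => hO y (by simpa [ones] using hy)
    have hrun := cookFn_apply (χ := χ) (p := p) (e := e) (u₁ := ones K₁) (u₂ := ones K₂) hO' z
    simp only [ckF, Function.comp_apply, fanoutFn_apply, f0, f1, f2, hfe, f4, hones1, hones2]
    rw [hrun]
    simp only [ones, List.length_replicate, cookSem]
    rw [hb]
    simp [encOut]
  -- assemble
  have htyp : (headBitFn ∘ nthF 3) ρ = [typ] := by simp [Function.comp_apply, f3, headBitFn_apply]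
  show true :: iteFn (headBitFn ∘ nthF 3) _ _ ρ = _
  cases typ
  · rw [iteFn_apply_false htyp, xorFn_apply haz hck, if_neg Bool.false_ne_true]
    simp [encOpt]
  · rw [iteFn_apply_true htyp, xorFn_apply hbz hacc, if_pos rfl]
    simp [encOpt]

end Semantics

end Ladner

end Literature.Computability.Complexity

end
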